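import Literature.RepresentationTheory.GeneralLinear.WreathOrbitSums
import Mathlib.GroupTheory.Perm.Fin
import HarnessLib

/-!
# Inserting a new first letter into every block: the combinatorics of Fischer–Ikenmeyer's
# Fact 2 / Lemma 1 ("prepending a row of width `n`")

N. Fischer, C. Ikenmeyer, *The computational complexity of plethysm coefficients*, Comput.
Complexity 29 (2020) 8, §4, Fact 2 ([Manivel–Michałek 2015]): "Let `ν` be a partition of `n`, let
`λ` be a partition of `n·m` of width at most `n` and let `π` be the partition after prepending a row
of width `n` to `λ`. Then the multiplicity of `S^λ V` in `S^ν Λᵐ V` equals the multiplicity of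
`S^π V` in `S^ν Λ^{m+1} V`", used in Lemma 1 to pass from inner parameter `m` to `m + 1`.

In the word model (`WreathHighestWeight.lean`) the passage `Λᵐ V ↦ Λ^{m+1} V` inside each of the `n`
blocks is realised by a new FIRST letter: the alphabet `Fin M` becomes `Fin (M + 1)` (old letters
shifted by `Fin.succ`, the new letter is `0`, the greatest basis vector for the upper triangular
Borel), and each block of `m` places gets a new place `0` carrying the letter `0`:

* `insertWord u` (`Word M (n·m) → Word (M+1) (n·(m+1))`), injective, with the reconstruction of a
  word with exactly the letter `0` at the places `0` (`exists_insertWord_eq`);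
* the lift `liftH : S_n ≀ S_m → S_n ≀ S_{m+1}` (same block permutation, inner permutations fixing
  the new place; `liftPerm` = Mathlib's `decomposeFin.symm (0, ·)`) with
  `insertWord u ∘ liftH τ = insertWord (u ∘ τ)`, its descent `descH` on the elements whose inner
  permutations fix place `0`, and the sign bookkeeping `s(liftH τ) = s(τ)·σₒ(τ)`, `σₒ(liftH τ) = σₒ(τ)`
  (a permutation `π` of the blocks now also permutes the `n` new places);
* the matrix side: an upper triangular `b ∈ GL_{M+1}` has an upper triangular CORNER
  `cornerGL b ∈ GL_M` (`det b = b₀₀ · det corner`), with `b^{(n,μ)} = b₀₀ⁿ · corner^{μ}`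
  (`weightChar_cons`), and conversely `oneSumGL b' = 1 ⊕ b'`; the Kronecker-power entries factor,
  `b_{(ι v'),(ι v)} = b₀₀ⁿ · b'_{v',v}` (`tensorPowerMatrix_insertWord`), and an entry `b_{w, ι v}`
  with `w` outside the image of `ι` vanishes unless `w` carries the letter `0` twice in some block
  (`two_zeros_of_tensorPowerMatrix_ne_zero`).

These are the ingredients of the isomorphism `wreathHW χ μ ≅ wreathHW χ' (n, μ)` of
`WreathPrepend.lean`.

## References

* [FischerIkenmeyer2020] §4 (Lemma 1, Fact 2).
* [FultonHarrisGTM129] §15.3 (Borel subgroup, weights).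
-/

noncomputable section

open scoped BigOperators

namespace Literature.RepresentationTheory.GeneralLinear

open Literature.NumberTheory.DiophantineGeometry Literature.Computability.AlgebraicComplexity

/-! ### Permutations of `Fin (m+1)` fixing `0` -/

section LiftPerm

variable {m : ℕ}

/-- The permutation of `Fin (m+1)` fixing `0` and acting as `σ` on the successors (Mathlib's
`decomposeFin.symm (0, σ)`). [folklore] -/
def liftPerm (σ : Equiv.Perm (Fin m)) : Equiv.Perm (Fin (m + 1)) :=
  Equiv.Perm.decomposeFin.symm (0, σ)

/-- `liftPerm σ 0 = 0`. [folklore] -/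
@[simp]
theorem liftPerm_zero (σ : Equiv.Perm (Fin m)) : liftPerm σ 0 = 0 :=
  Equiv.Perm.decomposeFin_symm_apply_zero 0 σ

/-- `liftPerm σ (p+1) = σ p + 1`. [folklore] -/
@[simp]
theorem liftPerm_succ (σ : Equiv.Perm (Fin m)) (p : Fin m) : liftPerm σ p.succ = (σ p).succ := by
  rw [liftPerm, Equiv.Perm.decomposeFin_symm_apply_succ, Equiv.swap_self, Equiv.refl_apply]

/-- `sign (liftPerm σ) = sign σ`. [folklore] -/
theorem sign_liftPerm (σ : Equiv.Perm (Fin m)) : Equiv.Perm.sign (liftPerm σ) = Equiv.Perm.sign σ := by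
  rw [liftPerm, Equiv.Perm.decomposeFin.symm_sign, if_pos rfl, one_mul]

/-- `liftPerm 1 = 1`. [folklore] -/
theorem liftPerm_one : liftPerm (1 : Equiv.Perm (Fin m)) = 1 := by
  refine Equiv.ext fun p => Fin.cases ?_ (fun q => ?_) p
  · rw [liftPerm_zero, Equiv.Perm.coe_one, id_eq]
  · rw [liftPerm_succ, Equiv.Perm.coe_one, Equiv.Perm.coe_one, id_eq, id_eq]

/-- The permutation of the successors induced by a permutation of `Fin (m+1)` (meaningful when it
fixes `0`). [folklore] -/
def descPerm (σ' : Equiv.Perm (Fin (m + 1))) : Equiv.Perm (Fin m) :=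
  (Equiv.Perm.decomposeFin σ').2

/-- A permutation fixing `0` is the lift of its descent. [folklore] -/
theorem liftPerm_descPerm {σ' : Equiv.Perm (Fin (m + 1))} (h : σ' 0 = 0) :
    liftPerm (descPerm σ') = σ' := by
  have key : Equiv.Perm.decomposeFin.symm
      ((Equiv.Perm.decomposeFin σ').1, (Equiv.Perm.decomposeFin σ').2) = σ' := by
    rw [Prod.mk.eta, Equiv.symm_apply_apply]
  have h1 : (Equiv.Perm.decomposeFin σ').1 = 0 := by
    have := congrArg (fun τ : Equiv.Perm (Fin (m + 1)) => τ 0) key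
    simp only [Equiv.Perm.decomposeFin_symm_apply_zero] at this
    rw [this, h]
  rw [h1] at key
  exact key

/-- Values of a permutation fixing `0` on successors. [folklore] -/
theorem apply_succ_of_apply_zero {σ' : Equiv.Perm (Fin (m + 1))} (h : σ' 0 = 0) (p : Fin m) :
    σ' p.succ = (descPerm σ' p).succ := by
  conv_lhs => rw [← liftPerm_descPerm h]
  rw [liftPerm_succ]

end LiftPerm

/-! ### Inserting the letter `0` at place `0` of every block -/

section Insert

variable {M n m : ℕ}

/-- **`ι`**: insert the new letter `0` at a new first place of every block and shift the old
letters by one (`Λᵐ V' ↪ Λ^{m+1} V`, `ω ↦ e₀ ∧ ω`, blockwise). [cite: FischerIkenmeyer2020, §4 (Fact 2: "prepending a row of width n")] -/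
def insertWord (u : Word M (n * m)) : Word (M + 1) (n * (m + 1)) := fun q =>
  Fin.cases (motive := fun _ => Fin (M + 1)) 0
    (fun p => (u (finProdFinEquiv ((finProdFinEquiv.symm q).1, p))).succ) (finProdFinEquiv.symm q).2

/-- Place `0` of every block of `ι u` carries the letter `0`. [folklore] -/
@[simp]
theorem insertWord_zero (u : Word M (n * m)) (r : Fin n) :
    insertWord u (finProdFinEquiv (r, (0 : Fin (m + 1)))) = 0 := by
  simp [insertWord]

/-- Place `p+1` of block `r` of `ι u` carries the letter `u(r,p) + 1`. [folklore] -/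
@[simp]
theorem insertWord_succ (u : Word M (n * m)) (r : Fin n) (p : Fin m) :
    insertWord u (finProdFinEquiv (r, p.succ)) = (u (finProdFinEquiv (r, p))).succ := by
  simp [insertWord]

/-- `ι` is injective. [folklore] -/
theorem insertWord_injective : Function.Injective (insertWord (M := M) (n := n) (m := m)) := by
  intro u v h
  funext q
  obtain ⟨⟨r, p⟩, rfl⟩ := finProdFinEquiv.surjective q
  have := congrFun h (finProdFinEquiv (r, p.succ))
  rw [insertWord_succ, insertWord_succ] at this
  exact Fin.succ_injective _ this

/-- **Reconstruction**: a word with the letter `0` at every place `0` and nowhere else in the places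
`p + 1` is `ι v` for some `v`. [folklore] -/
theorem exists_insertWord_eq {w : Word (M + 1) (n * (m + 1))}
    (h0 : ∀ r, w (finProdFinEquiv (r, (0 : Fin (m + 1)))) = 0)
    (h1 : ∀ r (p : Fin m), w (finProdFinEquiv (r, p.succ)) ≠ 0) : ∃ v, insertWord v = w := by
  refine ⟨fun q => (w (finProdFinEquiv ((finProdFinEquiv.symm q).1,
    (finProdFinEquiv.symm q).2.succ))).pred (h1 _ _), ?_⟩
  funext q
  obtain ⟨⟨r, p⟩, rfl⟩ := finProdFinEquiv.surjective q
  refine Fin.cases ?_ (fun p' => ?_) p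
  · rw [insertWord_zero, h0]
  · rw [insertWord_succ]
    simp

/-- The letters of `ι v` at places `p + 1` are nonzero. [folklore] -/
theorem insertWord_succ_ne_zero (v : Word M (n * m)) (r : Fin n) (p : Fin m) :
    insertWord v (finProdFinEquiv (r, p.succ)) ≠ 0 := by
  rw [insertWord_succ]
  exact Fin.succ_ne_zero _

/-- The content of `ι u`: the new letter `0` occurs `n` times, the letter `i + 1` as often as `i`
occurs in `u`. [folklore] -/
theorem wordContent_insertWord (u : Word M (n * m)) :
    (fun i => (wordContent (insertWord u) i : ℤ)) = Fin.cons (n : ℤ) fun i => (wordContent u i : ℤ) := by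
  funext i
  refine Fin.cases ?_ (fun j => ?_) i
  · simp only [Fin.cons_zero, Nat.cast_inj, wordContent]
    rw [Finset.card_filter, ← Equiv.sum_comp finProdFinEquiv, Fintype.sum_prod_type]
    simp only [Fin.sum_univ_succ, insertWord_zero, if_true, insertWord_succ, Fin.succ_ne_zero, if_false,
      Finset.sum_const_zero, add_zero, Finset.sum_const, Finset.card_univ, Fintype.card_fin, smul_eq_mul,
      mul_one]
  · simp only [Fin.cons_succ, Nat.cast_inj, wordContent]
    rw [Finset.card_filter, Finset.card_filter, ← Equiv.sum_comp finProdFinEquiv, Fintype.sum_prod_type,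
      ← Equiv.sum_comp finProdFinEquiv (fun q => if u q = j then 1 else 0), Fintype.sum_prod_type]
    refine Finset.sum_congr rfl fun r _ => ?_
    rw [Fin.sum_univ_succ, insertWord_zero, if_neg (Fin.succ_ne_zero j).symm, zero_add]
    refine Finset.sum_congr rfl fun p _ => ?_
    simp only [insertWord_succ, Fin.succ_inj]

end Insert

/-! ### Lifting and descending elements of the wreath product -/

section LiftH

variable {n m : ℕ}

/-- `blockMap` of a product `outerBlockPerm π * innerBlockPerm e` is `π`. [folklore] -/
theorem blockMapFun_outer_mul_inner {m' : ℕ} [NeZero m'] (π : Equiv.Perm (Fin n))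
    (e : Fin n → Equiv.Perm (Fin m')) (r : Fin n) :
    blockMapFun (outerBlockPerm n m' π * innerBlockPerm n m' e) r = π r := by
  simp [blockMapFun, Equiv.Perm.mul_apply, innerBlockPerm_apply, outerBlockPerm_apply]

/-- `innerFun` of a product `outerBlockPerm π * innerBlockPerm e` is `e`. [folklore] -/
theorem innerFun_outer_mul_inner {m' : ℕ} (π : Equiv.Perm (Fin n)) (e : Fin n → Equiv.Perm (Fin m'))
    (r : Fin n) (p : Fin m') :
    innerFun (outerBlockPerm n m' π * innerBlockPerm n m' e) r p = e r p := by
  simp [innerFun, Equiv.Perm.mul_apply, innerBlockPerm_apply, outerBlockPerm_apply]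

/-- The product `outerBlockPerm π * innerBlockPerm e` lies in the wreath product. [folklore] -/
theorem outer_mul_inner_mem {m' : ℕ} (π : Equiv.Perm (Fin n)) (e : Fin n → Equiv.Perm (Fin m')) :
    outerBlockPerm n m' π * innerBlockPerm n m' e ∈ blockPerms n m' :=
  (blockPerms n m').mul_mem (outerBlockPerm_mem_blockPerms π) (innerBlockPerm_mem_blockPerms e)

/-- `blockMap ⟨outerBlockPerm π * innerBlockPerm e, _⟩ = π`. [folklore] -/
theorem blockMap_outer_mul_inner {m' : ℕ} [NeZero m'] (π : Equiv.Perm (Fin n))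
    (e : Fin n → Equiv.Perm (Fin m')) :
    blockMap (⟨outerBlockPerm n m' π * innerBlockPerm n m' e, outer_mul_inner_mem π e⟩ :
      ↥(blockPerms n m')) = π :=
  Equiv.ext fun r => blockMapFun_outer_mul_inner π e r

/-- `innerPerm ⟨outerBlockPerm π * innerBlockPerm e, _⟩ r = e r`. [folklore] -/
theorem innerPerm_outer_mul_inner {m' : ℕ} [NeZero m'] (π : Equiv.Perm (Fin n))
    (e : Fin n → Equiv.Perm (Fin m')) (r : Fin n) :
    innerPerm (⟨outerBlockPerm n m' π * innerBlockPerm n m' e, outer_mul_inner_mem π e⟩ :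
      ↥(blockPerms n m')) r = e r :=
  Equiv.ext fun p => innerFun_outer_mul_inner π e r p

variable [NeZero m]

/-- **The lift `S_n ≀ S_m → S_n ≀ S_{m+1}`**: same permutation of the blocks, inner permutations
fixing the new place `0`. [cite: FischerIkenmeyer2020, §4 (Fact 2)] -/
def liftH (τ : ↥(blockPerms n m)) : ↥(blockPerms n (m + 1)) :=
  ⟨outerBlockPerm n (m + 1) (blockMap τ) * innerBlockPerm n (m + 1) fun r => liftPerm (innerPerm τ r),
    outer_mul_inner_mem _ _⟩

/-- The lift on place `0` of block `r`. [folklore] -/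
theorem liftH_apply_zero (τ : ↥(blockPerms n m)) (r : Fin n) :
    (liftH τ : Equiv.Perm (Fin (n * (m + 1)))) (finProdFinEquiv (r, 0)) = finProdFinEquiv (blockMap τ r, 0) := by
  change (outerBlockPerm n (m + 1) (blockMap τ) * innerBlockPerm n (m + 1) fun r => liftPerm (innerPerm τ r))
    (finProdFinEquiv (r, 0)) = _
  rw [Equiv.Perm.mul_apply, innerBlockPerm_apply, liftPerm_zero, outerBlockPerm_apply]

/-- The lift on place `p + 1` of block `r`. [folklore] -/
theorem liftH_apply_succ (τ : ↥(blockPerms n m)) (r : Fin n) (p : Fin m) :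
    (liftH τ : Equiv.Perm (Fin (n * (m + 1)))) (finProdFinEquiv (r, p.succ)) =
      finProdFinEquiv (blockMap τ r, (innerPerm τ r p).succ) := by
  change (outerBlockPerm n (m + 1) (blockMap τ) * innerBlockPerm n (m + 1) fun r => liftPerm (innerPerm τ r))
    (finProdFinEquiv (r, p.succ)) = _
  rw [Equiv.Perm.mul_apply, innerBlockPerm_apply, liftPerm_succ, outerBlockPerm_apply]

/-- **`ι` intertwines the lift**: `insertWord u ∘ liftH τ = insertWord (u ∘ τ)`. [cite: FischerIkenmeyer2020, §4 (Fact 2)] -/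
theorem insertWord_comp_liftH {M : ℕ} (u : Word M (n * m)) (τ : ↥(blockPerms n m)) :
    insertWord u ∘ ⇑(liftH τ : Equiv.Perm (Fin (n * (m + 1)))) =
      insertWord (u ∘ ⇑(τ : Equiv.Perm (Fin (n * m)))) := by
  funext q
  obtain ⟨⟨r, p⟩, rfl⟩ := finProdFinEquiv.surjective q
  refine Fin.cases ?_ (fun p' => ?_) p
  · rw [Function.comp_apply, liftH_apply_zero, insertWord_zero, insertWord_zero]
  · rw [Function.comp_apply, liftH_apply_succ, insertWord_succ, insertWord_succ, Function.comp_apply,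
      apply_finProdFinEquiv_of_mem τ.2]
    rfl

/-- `blockMap (liftH τ) = blockMap τ`. [folklore] -/
theorem blockMap_liftH (τ : ↥(blockPerms n m)) : blockMap (liftH τ) = blockMap τ :=
  blockMap_outer_mul_inner _ _

/-- `innerPerm (liftH τ) r = liftPerm (innerPerm τ r)`. [folklore] -/
theorem innerPerm_liftH (τ : ↥(blockPerms n m)) (r : Fin n) :
    innerPerm (liftH τ) r = liftPerm (innerPerm τ r) :=
  innerPerm_outer_mul_inner _ _ r

/-- `σₒ (liftH τ) = σₒ τ`. [folklore] -/
theorem outerSign_liftH (τ : ↥(blockPerms n m)) : outerSign (liftH τ) = outerSign τ := by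
  rw [outerSign_apply, outerSign_apply, blockMap_liftH]

/-- **`s (liftH τ) = s τ · σₒ τ`**: the permutation `π` of the blocks now also permutes the `n` new
places (sign `(sign π)^{m+1}` instead of `(sign π)^m`). [cite: FischerIkenmeyer2020, §4 (Fact 2)] -/
theorem restrSign_liftH (τ : ↥(blockPerms n m)) :
    restrSign n (m + 1) (liftH τ) = restrSign n m τ * outerSign τ := by
  rw [restrSign_apply, restrSign_eq τ, outerSign_apply]
  change Equiv.Perm.sign (outerBlockPerm n (m + 1) (blockMap τ) *
    innerBlockPerm n (m + 1) fun r => liftPerm (innerPerm τ r)) = _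
  rw [map_mul, sign_outerBlockPerm, sign_innerBlockPerm]
  simp_rw [sign_liftPerm]
  rw [uzpow_add, uzpow_one]
  rw [mul_right_comm, mul_assoc (Equiv.Perm.sign (blockMap τ) ^ m), mul_comm _ (Equiv.Perm.sign (blockMap τ)),
    ← mul_assoc]

/-- **The descent** of an element of `S_n ≀ S_{m+1}` whose inner permutations fix place `0`.
[cite: FischerIkenmeyer2020, §4 (Fact 2)] -/
def descH (τ' : ↥(blockPerms n (m + 1))) : ↥(blockPerms n m) :=
  ⟨outerBlockPerm n m (blockMap τ') * innerBlockPerm n m fun r => descPerm (innerPerm τ' r),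
    outer_mul_inner_mem _ _⟩

/-- An element whose inner permutations fix place `0` is the lift of its descent. [folklore] -/
theorem liftH_descH {τ' : ↥(blockPerms n (m + 1))} (h : ∀ r, innerPerm τ' r 0 = 0) :
    liftH (descH τ') = τ' := by
  apply Subtype.ext
  change outerBlockPerm n (m + 1) (blockMap (descH τ')) *
    innerBlockPerm n (m + 1) (fun r => liftPerm (innerPerm (descH τ') r)) = _
  rw [descH, blockMap_outer_mul_inner]
  simp_rw [innerPerm_outer_mul_inner]
  rw [coe_eq_outer_mul_inner τ']
  congr 1
  congr 1
  funext r
  exact liftPerm_descPerm (h r)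

end LiftH

/-! ### The corner of an upper triangular matrix and the block-diagonal embedding -/

section Corner

variable {k : Type*} [Field k] {M : ℕ}

/-- The corner `(b_{i+1, j+1})` of a matrix. [folklore] -/
def cornerMatrix (b : Matrix (Fin (M + 1)) (Fin (M + 1)) k) : Matrix (Fin M) (Fin M) k :=
  Matrix.of fun i j => b i.succ j.succ

omit [Field k] in
/-- Entries of the corner. [folklore] -/
@[simp]
theorem cornerMatrix_apply (b : Matrix (Fin (M + 1)) (Fin (M + 1)) k) (i j : Fin M) :
    cornerMatrix b i j = b i.succ j.succ :=
  rfl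

/-- For an upper triangular `b`, `det b = b₀₀ · det (corner b)` (expansion along the first column).
[folklore] -/
theorem det_eq_mul_det_corner {b : GL (Fin (M + 1)) k} (hb : IsUpperTriangular b) :
    (b : Matrix (Fin (M + 1)) (Fin (M + 1)) k).det =
      (b : Matrix (Fin (M + 1)) (Fin (M + 1)) k) 0 0 * (cornerMatrix (b : Matrix (Fin (M + 1)) (Fin (M + 1)) k)).det := by
  rw [Matrix.det_succ_column_zero, Fin.sum_univ_succ, Finset.sum_eq_zero]
  · simp only [Fin.val_zero, pow_zero, one_mul, add_zero, Fin.succAbove_zero]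
    rfl
  · intro i _
    rw [hb.apply_eq_zero (Fin.succ_pos i), mul_zero, zero_mul]

/-- **The corner of an invertible upper triangular matrix**, as an element of `GL_M`.
[cite: FultonHarrisGTM129, §15.3] -/
def cornerGL (b : GL (Fin (M + 1)) k) (hb : IsUpperTriangular b) : GL (Fin M) k :=
  Matrix.GeneralLinearGroup.mkOfDetNeZero (cornerMatrix (b : Matrix (Fin (M + 1)) (Fin (M + 1)) k)) (by
    intro h
    have hdet := det_eq_mul_det_corner hb
    rw [h, mul_zero] at hdet
    exact (Matrix.isUnits_det_units b).ne_zero hdet)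

/-- Entries of the corner. [folklore] -/
@[simp]
theorem cornerGL_apply (b : GL (Fin (M + 1)) k) (hb : IsUpperTriangular b) (i j : Fin M) :
    (cornerGL b hb : Matrix (Fin M) (Fin M) k) i j = (b : Matrix (Fin (M + 1)) (Fin (M + 1)) k) i.succ j.succ := by
  simp [cornerGL, Matrix.GeneralLinearGroup.val_mkOfDetNeZero]

/-- The corner of an upper triangular matrix is upper triangular. [cite: FultonHarrisGTM129, §15.3] -/
theorem isUpperTriangular_cornerGL (b : GL (Fin (M + 1)) k) (hb : IsUpperTriangular b) :
    IsUpperTriangular (cornerGL b hb) := by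
  intro i j hij
  rw [cornerGL_apply]
  exact hb.apply_eq_zero (Fin.succ_lt_succ_iff.mpr hij)

/-- **The weight character of a prepended weight**: `b^{(a, μ)} = b₀₀ᵃ · corner(b)^{μ}`.
[cite: FischerIkenmeyer2020, §4 (Fact 2)] -/
theorem weightChar_cons (b : GL (Fin (M + 1)) k) (hb : IsUpperTriangular b) (a : ℤ) (μ : Weight (Fin M)) :
    weightChar (Fin.cons a μ : Weight (Fin (M + 1))) b =
      (b : Matrix (Fin (M + 1)) (Fin (M + 1)) k) 0 0 ^ a * weightChar μ (cornerGL b hb) := by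
  simp only [weightChar, Fin.prod_univ_succ, Fin.cons_zero, Fin.cons_succ, cornerGL_apply]

/-- The block-diagonal matrix `1 ⊕ b'`. [folklore] -/
def oneSumMatrix (b' : Matrix (Fin M) (Fin M) k) : Matrix (Fin (M + 1)) (Fin (M + 1)) k :=
  Matrix.of fun i j => Fin.cases (Fin.cases 1 (fun _ => 0) j) (fun i' => Fin.cases 0 (fun j' => b' i' j') j) i

/-- Entries of `1 ⊕ b'`. [folklore] -/
theorem oneSumMatrix_zero_zero (b' : Matrix (Fin M) (Fin M) k) : oneSumMatrix b' 0 0 = 1 := rfl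

/-- Entries of `1 ⊕ b'`. [folklore] -/
theorem oneSumMatrix_zero_succ (b' : Matrix (Fin M) (Fin M) k) (j : Fin M) : oneSumMatrix b' 0 j.succ = 0 := by
  simp [oneSumMatrix]

/-- Entries of `1 ⊕ b'`. [folklore] -/
theorem oneSumMatrix_succ_zero (b' : Matrix (Fin M) (Fin M) k) (i : Fin M) : oneSumMatrix b' i.succ 0 = 0 := by
  simp [oneSumMatrix]

/-- Entries of `1 ⊕ b'`. [folklore] -/
theorem oneSumMatrix_succ_succ (b' : Matrix (Fin M) (Fin M) k) (i j : Fin M) :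
    oneSumMatrix b' i.succ j.succ = b' i j := by
  simp [oneSumMatrix]

/-- `1 ⊕ ·` is multiplicative. [folklore] -/
theorem oneSumMatrix_mul (b b' : Matrix (Fin M) (Fin M) k) :
    oneSumMatrix b * oneSumMatrix b' = oneSumMatrix (b * b') := by
  ext i j
  rw [Matrix.mul_apply, Fin.sum_univ_succ]
  refine Fin.cases ?_ (fun i' => ?_) i <;> refine Fin.cases ?_ (fun j' => ?_) j
  · simp [oneSumMatrix_zero_zero, oneSumMatrix_zero_succ, oneSumMatrix_succ_zero]
  · simp [oneSumMatrix_zero_zero, oneSumMatrix_zero_succ, oneSumMatrix_succ_succ]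
  · simp [oneSumMatrix_zero_zero, oneSumMatrix_succ_zero, oneSumMatrix_succ_succ]
  · simp [oneSumMatrix_zero_succ, oneSumMatrix_succ_zero, oneSumMatrix_succ_succ, Matrix.mul_apply]

/-- `1 ⊕ 1 = 1`. [folklore] -/
theorem oneSumMatrix_one : oneSumMatrix (1 : Matrix (Fin M) (Fin M) k) = 1 := by
  ext i j
  refine Fin.cases ?_ (fun i' => ?_) i <;> refine Fin.cases ?_ (fun j' => ?_) j
  · rw [oneSumMatrix_zero_zero, Matrix.one_apply_eq]
  · rw [oneSumMatrix_zero_succ, Matrix.one_apply_ne (Fin.succ_ne_zero j').symm]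
  · rw [oneSumMatrix_succ_zero, Matrix.one_apply_ne (Fin.succ_ne_zero i')]
  · rw [oneSumMatrix_succ_succ]
    by_cases h : i' = j'
    · subst h; rw [Matrix.one_apply_eq, Matrix.one_apply_eq]
    · rw [Matrix.one_apply_ne h, Matrix.one_apply_ne (fun e => h (Fin.succ_injective _ e))]

/-- **The block-diagonal embedding `GL_M → GL_{M+1}`, `b' ↦ 1 ⊕ b'`.** [cite: FultonHarrisGTM129, §15.3] -/
def oneSumGL (b' : GL (Fin M) k) : GL (Fin (M + 1)) k where
  val := oneSumMatrix (b' : Matrix (Fin M) (Fin M) k)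
  inv := oneSumMatrix ((b'⁻¹ : GL (Fin M) k) : Matrix (Fin M) (Fin M) k)
  val_inv := by rw [oneSumMatrix_mul, ← Units.val_mul, mul_inv_cancel, Units.val_one, oneSumMatrix_one]
  inv_val := by rw [oneSumMatrix_mul, ← Units.val_mul, inv_mul_cancel, Units.val_one, oneSumMatrix_one]

/-- The matrix of `oneSumGL b'`. [folklore] -/
theorem coe_oneSumGL (b' : GL (Fin M) k) :
    ((oneSumGL b' : GL (Fin (M + 1)) k) : Matrix (Fin (M + 1)) (Fin (M + 1)) k) =
      oneSumMatrix (b' : Matrix (Fin M) (Fin M) k) :=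
  rfl

/-- `1 ⊕ b'` is upper triangular when `b'` is. [cite: FultonHarrisGTM129, §15.3] -/
theorem isUpperTriangular_oneSumGL {b' : GL (Fin M) k} (hb' : IsUpperTriangular b') :
    IsUpperTriangular (oneSumGL b') := by
  intro i j hij
  rw [coe_oneSumGL]
  revert hij
  refine Fin.cases ?_ (fun i' => ?_) i <;> refine Fin.cases ?_ (fun j' => ?_) j <;> intro hij
  · exact absurd hij (lt_irrefl _)
  · exact absurd hij (not_lt.mpr (Fin.zero_le _))
  · exact oneSumMatrix_succ_zero _ i'
  · rw [oneSumMatrix_succ_succ]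
    exact hb'.apply_eq_zero (Fin.succ_lt_succ_iff.mp hij)

/-- The weight character of a prepended weight at `1 ⊕ b'`: `(1 ⊕ b')^{(a, μ)} = b'^{μ}`. [folklore] -/
theorem weightChar_cons_oneSumGL (b' : GL (Fin M) k) (a : ℤ) (μ : Weight (Fin M)) :
    weightChar (Fin.cons a μ : Weight (Fin (M + 1))) (oneSumGL b') = weightChar μ b' := by
  rw [weightChar, weightChar, Fin.prod_univ_succ, Fin.cons_zero, coe_oneSumGL, oneSumMatrix_zero_zero, one_zpow,
    one_mul]
  refine Finset.prod_congr rfl fun i _ => ?_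
  rw [Fin.cons_succ, oneSumMatrix_succ_succ]

end Corner

/-! ### Kronecker-power entries against inserted words -/

section TPM

variable {k : Type*} [Field k] {M n m : ℕ}

/-- **Factorisation of the Kronecker power on inserted words**:
`b_{ι v', ι v} = b₀₀ⁿ · ∏_q b_{v' q + 1, v q + 1} = b₀₀ⁿ · corner(b)_{v', v}`. [cite: FischerIkenmeyer2020, §4 (Fact 2)] -/
theorem tensorPowerMatrix_insertWord (b : Matrix (Fin (M + 1)) (Fin (M + 1)) k) (v' v : Word M (n * m)) :
    tensorPowerMatrix k (M + 1) (n * (m + 1)) b (insertWord v') (insertWord v) =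
      b 0 0 ^ n * tensorPowerMatrix k M (n * m) (cornerMatrix b) v' v := by
  rw [tensorPowerMatrix_apply, tensorPowerMatrix_apply,
    ← Equiv.prod_comp finProdFinEquiv (fun q => b (insertWord v' q) (insertWord v q)),
    ← Equiv.prod_comp finProdFinEquiv (fun q => cornerMatrix b (v' q) (v q)),
    Fintype.prod_prod_type, Fintype.prod_prod_type]
  simp only [Fin.prod_univ_succ, insertWord_zero, insertWord_succ, cornerMatrix_apply]
  rw [Finset.prod_mul_distrib, Finset.prod_const, Finset.card_univ, Fintype.card_fin]

/-- The same for the corner of an invertible upper triangular matrix. [cite: FischerIkenmeyer2020, §4 (Fact 2)] -/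
theorem tensorPowerMatrix_insertWord_cornerGL (b : GL (Fin (M + 1)) k) (hb : IsUpperTriangular b)
    (v' v : Word M (n * m)) :
    tensorPowerMatrix k (M + 1) (n * (m + 1)) (b : Matrix (Fin (M + 1)) (Fin (M + 1)) k) (insertWord v') (insertWord v) =
      (b : Matrix (Fin (M + 1)) (Fin (M + 1)) k) 0 0 ^ n *
        tensorPowerMatrix k M (n * m) (cornerGL b hb : Matrix (Fin M) (Fin M) k) v' v := by
  have hc : cornerMatrix (b : Matrix (Fin (M + 1)) (Fin (M + 1)) k) = (cornerGL b hb : Matrix (Fin M) (Fin M) k) := by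
    ext i j; rw [cornerMatrix_apply, cornerGL_apply]
  rw [tensorPowerMatrix_insertWord, hc]

/-- **Off the image of `ι`, entries against `ι v` see a repeated letter `0`**: for upper triangular
`b`, if `b_{w, ι v} ≠ 0` and `w` is not of the form `ι v'`, then some block of `w` carries the letter
`0` at place `0` and at some place `p + 1`. [cite: FischerIkenmeyer2020, §4 (Fact 2)] -/
theorem two_zeros_of_tensorPowerMatrix_ne_zero {b : GL (Fin (M + 1)) k} (hb : IsUpperTriangular b)
    {w : Word (M + 1) (n * (m + 1))} {v : Word M (n * m)}
    (hne : tensorPowerMatrix k (M + 1) (n * (m + 1)) (b : Matrix (Fin (M + 1)) (Fin (M + 1)) k) w (insertWord v) ≠ 0)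
    (hw : ∀ v', insertWord v' ≠ w) :
    ∃ (r : Fin n) (p : Fin m), w (finProdFinEquiv (r, 0)) = 0 ∧ w (finProdFinEquiv (r, p.succ)) = 0 := by
  -- letterwise `w ≤ ι v`
  have hle : ∀ q, w q ≤ insertWord v q := fun q => by
    by_contra hlt
    push Not at hlt
    apply hne
    rw [tensorPowerMatrix_apply]
    exact Finset.prod_eq_zero (Finset.mem_univ q) (hb.apply_eq_zero hlt)
  have h0 : ∀ r, w (finProdFinEquiv (r, 0)) = 0 := fun r => by
    have := hle (finProdFinEquiv (r, 0))
    rw [insertWord_zero] at this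
    exact le_antisymm this (Fin.zero_le _)
  by_contra hcon
  push Not at hcon
  obtain ⟨v', hv'⟩ := exists_insertWord_eq h0 fun r p => hcon r p (h0 r)
  exact hw v' hv'

/-- Entries of `1 ⊕ b'` against an inserted word vanish off the image of `ι`. [folklore] -/
theorem tensorPowerMatrix_oneSum_eq_zero (b' : Matrix (Fin M) (Fin M) k) (u : Word M (n * m))
    {w : Word (M + 1) (n * (m + 1))} (hw : ∀ v, insertWord v ≠ w) :
    tensorPowerMatrix k (M + 1) (n * (m + 1)) (oneSumMatrix b') (insertWord u) w = 0 := by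
  by_contra hne
  rw [tensorPowerMatrix_apply] at hne
  have hfac : ∀ q, oneSumMatrix b' (insertWord u q) (w q) ≠ 0 := fun q h =>
    hne (Finset.prod_eq_zero (Finset.mem_univ q) h)
  have h0 : ∀ r, w (finProdFinEquiv (r, 0)) = 0 := fun r => by
    have h := hfac (finProdFinEquiv (r, 0))
    rw [insertWord_zero] at h
    by_contra hz
    obtain ⟨j, hj⟩ := Fin.exists_succ_eq.mpr hz
    rw [← hj, oneSumMatrix_zero_succ] at h
    exact h rfl
  have h1 : ∀ r (p : Fin m), w (finProdFinEquiv (r, p.succ)) ≠ 0 := fun r p hz => by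
    have h := hfac (finProdFinEquiv (r, p.succ))
    rw [insertWord_succ, hz, oneSumMatrix_succ_zero] at h
    exact h rfl
  obtain ⟨v, hv⟩ := exists_insertWord_eq h0 h1
  exact hw v hv

/-- Entries of `1 ⊕ b'` between inserted words: `(1 ⊕ b')_{ι u, ι v} = b'_{u, v}`. [folklore] -/
theorem tensorPowerMatrix_oneSum_insertWord (b' : Matrix (Fin M) (Fin M) k) (u v : Word M (n * m)) :
    tensorPowerMatrix k (M + 1) (n * (m + 1)) (oneSumMatrix b') (insertWord u) (insertWord v) =
      tensorPowerMatrix k M (n * m) b' u v := by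
  have h := tensorPowerMatrix_insertWord (oneSumMatrix b') u v
  rw [oneSumMatrix_zero_zero, one_pow, one_mul] at h
  have hc : cornerMatrix (oneSumMatrix b') = b' := by
    ext i j; rw [cornerMatrix_apply, oneSumMatrix_succ_succ]
  exact h.trans (congrArg (fun X => tensorPowerMatrix k M (n * m) X u v) hc)

end TPM

end Literature.RepresentationTheory.GeneralLinear
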